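import Summits.AtomisticToContinuum.Crystallization.Theorems.ChargedEnergyGapStationRows
import Summits.AtomisticToContinuum.Crystallization.Theorems.ChargedEnergyGapFarkasKernel
import Summits.AtomisticToContinuum.Crystallization.Theorems.ChargedEnergyGapCellKernel
import Summits.AtomisticToContinuum.Crystallization.Theorems.ChargedEnergyGapPhiConvex
import HarnessLib

/-!
# ChargedEnergyGap · NODE 110D «StationSchema» — the station polytope's rows as ℚ DATA, each proved at the real valuation (door D5c, memo §13)

decomp-a2c lens-3 g92.  Imports lane 110A (rows), lane 110B (linear forms), tree 108B «CellKernel» (`depthProfileQ`, `qle`), tree N97 «PhiConvex».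

The VALUATION `sval dt : ℕ → ℝ` of a depth tuple: indices `0..6` the seven stencil depths `dt (stPt o)` (centre, (0,T), (0,F), (1,T), (1,F), (2,T),
(2,F)), `7..13` their squares, `14..19` the six weights `vtxW 160 dt 0 q = φ(dt (holeVertex 0 q))`, else `0`.  A `StationRowsCert` is rational data
(ρ-slab, depth box incl. the centre, square tangents, weight secants, oracle rows `S2Data`); `rows c : List LRow` EMITS the H-description and
★★ `rows_sound` proves every emitted row at `sval dt` from: `ρ ∈ [rho0, rho1]`, the box, `IsChartRealisable ρ dt`, positivity on the stencil.
Schemas: S1 box (hypotheses) · S2 oracle row (110A `stationRow_of_chart`, made ρ-free by monotonicity in `ρ ≤ rho1`) · S3 `dt ↔ dt²` (chord from the box,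
tangents from data) · S4 `dt ↔ W` (chord from the box by `depthProfile_chord_upper`, secants from data by `depthProfile_secant_lower`, exact `depthProfileQ`).

[SPLIT beneath (T¹ᶜ) (no EQUIV introduced) · data side of D5 · UNDECIDED(test = (D¹)) unchanged.] -/

namespace Summit.AtomisticToContinuum.Crystallization.Theorems.ChargedEnergyGapChartDial

/-! ## §110D.1 Indices and the valuation -/
section Valuation

/-- Index of a slot among the seven points: `(0,T) ↦ 1, (0,F) ↦ 2, (1,T) ↦ 3, (1,F) ↦ 4, (2,T) ↦ 5, (2,F) ↦ 6`. -/
def slotIx (q : Fin 3 × Bool) : ℕ := 2 * (q.1 : ℕ) + cond q.2 1 2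

/-- Index of one of the seven points (centre `↦ 0`). -/
def ptIx : Option (Fin 3 × Bool) → ℕ
  | none => 0
  | some q => slotIx q

/-- ★ The real VALUATION of a depth tuple: depths `0..6`, squares `7..13`, weights `14..19`. -/
noncomputable def sval (dt : (Fin 3 → ℤ) → ℝ) : ℕ → ℝ
  | 0 => dt (stPt none)
  | 1 => dt (stPt (some (0, true)))
  | 2 => dt (stPt (some (0, false)))
  | 3 => dt (stPt (some (1, true)))
  | 4 => dt (stPt (some (1, false)))
  | 5 => dt (stPt (some (2, true)))
  | 6 => dt (stPt (some (2, false)))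
  | 7 => dt (stPt none) ^ 2
  | 8 => dt (stPt (some (0, true))) ^ 2
  | 9 => dt (stPt (some (0, false))) ^ 2
  | 10 => dt (stPt (some (1, true))) ^ 2
  | 11 => dt (stPt (some (1, false))) ^ 2
  | 12 => dt (stPt (some (2, true))) ^ 2
  | 13 => dt (stPt (some (2, false))) ^ 2
  | 14 => vtxW 160 dt 0 (0, true)
  | 15 => vtxW 160 dt 0 (0, false)
  | 16 => vtxW 160 dt 0 (1, true)
  | 17 => vtxW 160 dt 0 (1, false)
  | 18 => vtxW 160 dt 0 (2, true)
  | 19 => vtxW 160 dt 0 (2, false)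
  | _ => 0

/-- `sval` at a depth index. -/
theorem sval_pt (dt : (Fin 3 → ℤ) → ℝ) (o : Option (Fin 3 × Bool)) : sval dt (ptIx o) = dt (stPt o) := by
  rcases o with _ | ⟨a, b⟩
  · rfl
  · fin_cases a <;> cases b <;> rfl

/-- `sval` at a square index. -/
theorem sval_sq (dt : (Fin 3 → ℤ) → ℝ) (o : Option (Fin 3 × Bool)) : sval dt (7 + ptIx o) = dt (stPt o) ^ 2 := by
  rcases o with _ | ⟨a, b⟩
  · rfl
  · fin_cases a <;> cases b <;> rfl

/-- `sval` at a weight index. -/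
theorem sval_w (dt : (Fin 3 → ℤ) → ℝ) (q : Fin 3 × Bool) : sval dt (13 + slotIx q) = depthProfile 160 (dt (stPt (some q))) := by
  obtain ⟨a, b⟩ := q
  fin_cases a <;> cases b <;> rfl

/-- The coefficient list `c·x_k`: `k` zeros then `c`. -/
def unitRow (k : ℕ) (c : ℚ) : List ℚ := List.replicate k 0 ++ [c]

/-- Leading zeros shift the variable offset. -/
theorem linAt_replicate_append (k : ℕ) (l : List ℚ) (x : ℕ → ℝ) (i : ℕ) :
    linAt (List.replicate k 0 ++ l) x i = linAt l x (i + k) := by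
  induction k generalizing i with
  | zero => simp
  | succ k ih => rw [List.replicate_succ, List.cons_append, linAt_cons, ih]; push_cast; ring_nf

/-- `linAt (unitRow k c) x 0 = c · x k`. -/
@[simp] theorem linAt_unitRow (k : ℕ) (c : ℚ) (x : ℕ → ℝ) : linAt (unitRow k c) x 0 = (c : ℝ) * x k := by
  simp [unitRow, linAt_replicate_append]

/-- Explicit seven-term sum over the seven points (kernel-friendly). -/
def sum7 (f : Option (Fin 3 × Bool) → ℚ) : ℚ :=
  f none + f (some (0, true)) + f (some (0, false)) + f (some (1, true)) + f (some (1, false)) + f (some (2, true)) + f (some (2, false))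

/-- `sum7` is the `Fintype` sum. -/
theorem cast_sum7 (f : Option (Fin 3 × Bool) → ℚ) : ((sum7 f : ℚ) : ℝ) = ∑ o, (f o : ℝ) := by
  rw [Fintype.sum_option, Fintype.sum_prod_type, Fin.sum_univ_three]
  simp only [Fintype.sum_bool, sum7]
  push_cast; ring

end Valuation

/-! ## §110D.2 Schema S2 — the oracle row of 110A, as data -/
section OracleRow

/-- Integer coordinate difference `(stPt o')_k − (stPt o)_k`. -/
def dG (o o' : Option (Fin 3 × Bool)) (k : Fin 3) : ℤ := stPt o' k - stPt o k

/-- Rational mirror of `stG`. -/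
def stGQ (o o' : Option (Fin 3 × Bool)) : ℚ := ((dG o o' 0 ^ 2 + dG o o' 1 ^ 2 + dG o o' 2 ^ 2 : ℤ) : ℚ)

/-- [cast] `stGQ = stG`. -/
theorem cast_stGQ (o o' : Option (Fin 3 × Bool)) : ((stGQ o o' : ℚ) : ℝ) = stG o o' := by
  simp only [stGQ, stG, dG, Fin.sum_univ_three]
  push_cast; ring

/-- ★ ONE ORACLE ROW as data: owner point `o`, seven non-negative weights `α`, norm bound `n`, slope point `s`. -/
structure S2Data where
  /-- owner point -/
  o : Option (Fin 3 × Bool)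
  /-- weight of the centre -/
  aC : ℚ
  /-- weight of (0,T) -/
  a0T : ℚ
  /-- weight of (0,F) -/
  a0F : ℚ
  /-- weight of (1,T) -/
  a1T : ℚ
  /-- weight of (1,F) -/
  a1F : ℚ
  /-- weight of (2,T) -/
  a2T : ℚ
  /-- weight of (2,F) -/
  a2F : ℚ
  /-- norm bound `n ≥ ‖Σ α (stPt o' − stPt o)‖` -/
  n : ℚ
  /-- AM–GM slope point `s > 0` -/
  s : ℚ

/-- The weights as a function of the point. -/
def S2Data.α (d : S2Data) : Option (Fin 3 × Bool) → ℚ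
  | none => d.aC
  | some (0, true) => d.a0T
  | some (0, false) => d.a0F
  | some (1, true) => d.a1T
  | some (1, false) => d.a1F
  | some (2, true) => d.a2T
  | some (2, false) => d.a2F

/-- The coefficient of the owner's square: `Σα + rho1·n/s`. -/
def S2Data.K (d : S2Data) (rho1 : ℚ) : ℚ := sum7 d.α + rho1 * d.n / d.s

/-- The emitted row `Σ α_o′ D_o′ − K·D_o ≤ rho1·n·s + rho1²·Σ α_o′ G(o,o′)` in the valuation indices. -/
def S2Data.row (d : S2Data) (rho1 : ℚ) : LRow :=
  ⟨axpy d.aC (unitRow 7 1) <| axpy d.a0T (unitRow 8 1) <| axpy d.a0F (unitRow 9 1) <| axpy d.a1T (unitRow 10 1) <|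
      axpy d.a1F (unitRow 11 1) <| axpy d.a2T (unitRow 12 1) <| axpy d.a2F (unitRow 13 1) <| unitRow (7 + ptIx d.o) (-(d.K rho1)),
    rho1 * d.n * d.s + rho1 ^ 2 * sum7 (fun o' => d.α o' * stGQ d.o o')⟩

/-- Side conditions: `0 < s`, `0 ≤ n`, `α ≥ 0`, `n² ≥ Σ_k (Σ_o′ α_o′ dG_k)²`. -/
def S2Data.ok (d : S2Data) : Bool :=
  decide (0 < d.s ∧ 0 ≤ d.n ∧ 0 ≤ d.aC ∧ 0 ≤ d.a0T ∧ 0 ≤ d.a0F ∧ 0 ≤ d.a1T ∧ 0 ≤ d.a1F ∧ 0 ≤ d.a2T ∧ 0 ≤ d.a2F ∧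
    sum7 (fun o' => d.α o' * dG d.o o' 0) ^ 2 + sum7 (fun o' => d.α o' * dG d.o o' 1) ^ 2 + sum7 (fun o' => d.α o' * dG d.o o' 2) ^ 2 ≤ d.n ^ 2)

/-- `α ≥ 0` pointwise from the side conditions. -/
theorem S2Data.α_nonneg (d : S2Data) (h0 : 0 ≤ d.aC) (h1 : 0 ≤ d.a0T) (h2 : 0 ≤ d.a0F) (h3 : 0 ≤ d.a1T) (h4 : 0 ≤ d.a1F) (h5 : 0 ≤ d.a2T)
    (h6 : 0 ≤ d.a2F) : ∀ o', (0 : ℝ) ≤ (d.α o' : ℝ) := by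
  rintro (_ | ⟨a, b⟩)
  · exact_mod_cast h0
  · fin_cases a <;> cases b
    all_goals simp only [S2Data.α]
    all_goals first | exact_mod_cast h1 | exact_mod_cast h2 | exact_mod_cast h3 | exact_mod_cast h4 | exact_mod_cast h5 | exact_mod_cast h6

/-- The left-hand side of the emitted row at the valuation. -/
theorem S2Data.linAt_row (d : S2Data) (rho1 : ℚ) (dt : (Fin 3 → ℤ) → ℝ) :
    linAt (d.row rho1).a (sval dt) 0 = (∑ o', (d.α o' : ℝ) * dt (stPt o') ^ 2) - (d.K rho1 : ℝ) * dt (stPt d.o) ^ 2 := by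
  simp only [S2Data.row, linAt_axpy, linAt_unitRow, sval_sq]
  rw [Fintype.sum_option, Fintype.sum_prod_type, Fin.sum_univ_three]
  simp only [Fintype.sum_bool, S2Data.α]
  simp only [sval]
  push_cast; ring

/-- ★★ SOUNDNESS OF S2: the emitted row holds at `sval dt` for every `ρ ∈ [0, rho1]` and every chart-realisable positive tuple. -/
theorem S2Data.row_sound (d : S2Data) (hok : d.ok = true) {ρ : ℝ} {rho1 : ℚ} (hρ0 : 0 ≤ ρ) (hρ1 : ρ ≤ rho1)
    {dt : (Fin 3 → ℤ) → ℝ} (h : IsChartRealisable ρ dt) (hpos : ∀ p ∈ stencil 0, 0 < dt p) :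
    linAt (d.row rho1).a (sval dt) 0 ≤ ((d.row rho1).b : ℝ) := by
  simp only [S2Data.ok, decide_eq_true_eq] at hok
  obtain ⟨hs, hn, h0, h1, h2, h3, h4, h5, h6, hnn⟩ := hok
  have hα := d.α_nonneg h0 h1 h2 h3 h4 h5 h6
  have hs' : (0 : ℝ) < (d.s : ℝ) := by exact_mod_cast hs
  have hn' : (0 : ℝ) ≤ (d.n : ℝ) := by exact_mod_cast hn
  have hp0 : 0 ≤ dt (stPt d.o) := (hpos _ (stPt_mem d.o)).le
  have hnorm : ∑ k, (∑ o', (d.α o' : ℝ) * (((stPt o') k - (stPt d.o) k : ℤ) : ℝ)) ^ 2 ≤ (d.n : ℝ) ^ 2 := by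
    have := qle hnn
    push_cast at this
    rw [cast_sum7, cast_sum7, cast_sum7] at this
    rw [Fin.sum_univ_three]
    simp only [dG] at this
    push_cast at this ⊢
    exact this
  have main := stationRow_of_chart h hρ0 d.o hp0 (fun o' => (d.α o' : ℝ)) hα hn' hnorm hs'
  rw [d.linAt_row]
  have hG : 0 ≤ ∑ o', (d.α o' : ℝ) * stG d.o o' :=
    Finset.sum_nonneg fun o' _ => mul_nonneg (hα o') (Finset.sum_nonneg fun k _ => sq_nonneg _)
  have hD : 0 ≤ dt (stPt d.o) ^ 2 := sq_nonneg _
  have hK : ((d.K rho1 : ℚ) : ℝ) = (∑ o', (d.α o' : ℝ)) + (rho1 : ℝ) * d.n / d.s := by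
    simp only [S2Data.K]; push_cast; rw [cast_sum7]
  have hb : (((d.row rho1).b : ℚ) : ℝ) = (rho1 : ℝ) * d.n * d.s + (rho1 : ℝ) ^ 2 * ∑ o', (d.α o' : ℝ) * stG d.o o' := by
    simp only [S2Data.row]; push_cast; rw [cast_sum7]; push_cast; simp only [cast_stGQ]
  rw [hK, hb]
  have e1 : ρ * d.n / d.s ≤ (rho1 : ℝ) * d.n / d.s := div_le_div_of_nonneg_right (mul_le_mul_of_nonneg_right hρ1 hn') hs'.le
  have e2 : ρ * d.n * d.s ≤ (rho1 : ℝ) * d.n * d.s := mul_le_mul_of_nonneg_right (mul_le_mul_of_nonneg_right hρ1 hn') hs'.le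
  have e3 : ρ ^ 2 * ∑ o', (d.α o' : ℝ) * stG d.o o' ≤ (rho1 : ℝ) ^ 2 * ∑ o', (d.α o' : ℝ) * stG d.o o' :=
    mul_le_mul_of_nonneg_right (pow_le_pow_left₀ hρ0 hρ1 2) hG
  have e1' := mul_le_mul_of_nonneg_right e1 hD
  linarith [main, e1', e2, e3]

end OracleRow

/-! ## §110D.3 Schemas S1/S3/S4 and the station row certificate -/
section Station

/-- The seven points as an explicit list. -/
def pts7 : List (Option (Fin 3 × Bool)) :=
  [none, some (0, true), some (0, false), some (1, true), some (1, false), some (2, true), some (2, false)]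

/-- The six slots as an explicit list. -/
def slots6 : List (Fin 3 × Bool) := [(0, true), (0, false), (1, true), (1, false), (2, true), (2, false)]

/-- ★ THE STATION ROW CERTIFICATE (data of the H-description): ρ-slab, the depth box of the six hole vertices and of the centre, square tangent
points, weight secant anchors, and the oracle rows. -/
structure StationRowsCert where
  /-- ρ-slab, low end (`≥ 0`) -/
  rho0 : ℚ
  /-- ρ-slab, high end -/
  rho1 : ℚ
  /-- depth box of the hole vertices, low corner -/
  lo : Fin 3 × Bool → ℚ
  /-- depth box of the hole vertices, high corner -/
  hi : Fin 3 × Bool → ℚ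
  /-- centre depth, low end -/
  loC : ℚ
  /-- centre depth, high end -/
  hiC : ℚ
  /-- square tangents `(o, c)`: rows `2c·x_o − D_o ≤ c²` -/
  tangents : List (Option (Fin 3 × Bool) × ℚ)
  /-- weight secant anchors `(q, a')` with `80 ≤ a' < lo q`: rows `φ(a') + m'(x_q − a') ≤ W_q` -/
  secants : List ((Fin 3 × Bool) × ℚ)
  /-- oracle rows -/
  s2 : List S2Data

/-- The box of the seven points. -/
def StationRowsCert.lo7 (c : StationRowsCert) : Option (Fin 3 × Bool) → ℚ
  | none => c.loC
  | some q => c.lo q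

/-- The box of the seven points. -/
def StationRowsCert.hi7 (c : StationRowsCert) : Option (Fin 3 × Bool) → ℚ
  | none => c.hiC
  | some q => c.hi q

/-- S1: the fourteen box rows. -/
def StationRowsCert.boxRows (c : StationRowsCert) : List LRow :=
  pts7.map (fun o => ⟨unitRow (ptIx o) 1, c.hi7 o⟩) ++ pts7.map (fun o => ⟨unitRow (ptIx o) (-1), -c.lo7 o⟩)

/-- S3 chord: `D_o − (a+b)·x_o ≤ −a·b` with `[a,b]` the box of `o`. -/
def StationRowsCert.sqChordRow (c : StationRowsCert) (o : Option (Fin 3 × Bool)) : LRow :=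
  ⟨axpy 1 (unitRow (7 + ptIx o) 1) (unitRow (ptIx o) (-(c.lo7 o + c.hi7 o))), -(c.lo7 o * c.hi7 o)⟩

/-- S3 tangent: `2c·x_o − D_o ≤ c²`. -/
def sqTangentRow (oc : Option (Fin 3 × Bool) × ℚ) : LRow :=
  ⟨axpy (2 * oc.2) (unitRow (ptIx oc.1) 1) (unitRow (7 + ptIx oc.1) (-1)), oc.2 ^ 2⟩

/-- The chord slope of `φ` on `[a, b]` (exact rationals). -/
def phiSlope (a b : ℚ) : ℚ := (depthProfileQ 160 b - depthProfileQ 160 a) / (b - a)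

/-- S4 chord: `W_q − m·x_q ≤ φ(lo) − m·lo`, `m` the chord slope on the box of `q`. -/
def StationRowsCert.wChordRow (c : StationRowsCert) (q : Fin 3 × Bool) : LRow :=
  ⟨axpy 1 (unitRow (13 + slotIx q) 1) (unitRow (slotIx q) (-(phiSlope (c.lo q) (c.hi q)))),
    depthProfileQ 160 (c.lo q) - phiSlope (c.lo q) (c.hi q) * c.lo q⟩

/-- S4 secant: `m'·x_q − W_q ≤ m'·a' − φ(a')`, `m'` the slope of `φ` on `[a', lo q]`. -/
def StationRowsCert.wSecantRow (c : StationRowsCert) (qa : (Fin 3 × Bool) × ℚ) : LRow :=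
  ⟨axpy (phiSlope qa.2 (c.lo qa.1)) (unitRow (slotIx qa.1) 1) (unitRow (13 + slotIx qa.1) (-1)),
    phiSlope qa.2 (c.lo qa.1) * qa.2 - depthProfileQ 160 qa.2⟩

/-- ★ THE EMITTED H-DESCRIPTION (base rows of the station polytope, in this order — the census indexes into it). -/
def StationRowsCert.rows (c : StationRowsCert) : List LRow :=
  c.boxRows ++ pts7.map c.sqChordRow ++ c.tangents.map sqTangentRow ++ slots6.map c.wChordRow ++ c.secants.map c.wSecantRow ++
    c.s2.map (fun d => d.row c.rho1)

/-- Side conditions of the data. -/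
def StationRowsCert.ok (c : StationRowsCert) : Bool :=
  decide (0 ≤ c.rho0 ∧ c.rho0 ≤ c.rho1 ∧ c.loC ≤ c.hiC) &&
    slots6.all (fun q => decide (80 ≤ c.lo q ∧ c.lo q < c.hi q ∧ c.hi q ≤ 134)) &&
    c.secants.all (fun qa => decide (80 ≤ qa.2 ∧ qa.2 < c.lo qa.1)) && c.s2.all S2Data.ok

variable {c : StationRowsCert} {ρ : ℝ} {dt : (Fin 3 → ℤ) → ℝ}

/-- Membership in the explicit slot list. -/
theorem mem_slots6 (q : Fin 3 × Bool) : q ∈ slots6 := by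
  obtain ⟨a, b⟩ := q; fin_cases a <;> cases b <;> simp [slots6]

/-- The seven-point box from the hypotheses. -/
theorem StationRowsCert.box7 (c : StationRowsCert) (hbox : ∀ q, (c.lo q : ℝ) ≤ dt (holeVertex 0 q) ∧ dt (holeVertex 0 q) ≤ c.hi q)
    (hC : (c.loC : ℝ) ≤ dt 0 ∧ dt 0 ≤ c.hiC) : ∀ o, (c.lo7 o : ℝ) ≤ dt (stPt o) ∧ dt (stPt o) ≤ c.hi7 o := by
  rintro (_ | q)
  · simpa [StationRowsCert.lo7, StationRowsCert.hi7] using hC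
  · simpa [StationRowsCert.lo7, StationRowsCert.hi7] using hbox q

/-- S1 soundness. -/
theorem StationRowsCert.boxRows_sound (c : StationRowsCert) (h7 : ∀ o, (c.lo7 o : ℝ) ≤ dt (stPt o) ∧ dt (stPt o) ≤ c.hi7 o) :
    ∀ r ∈ c.boxRows, linAt r.a (sval dt) 0 ≤ (r.b : ℝ) := by
  intro r hr
  simp only [StationRowsCert.boxRows, List.mem_append, List.mem_map] at hr
  rcases hr with ⟨o, _, rfl⟩ | ⟨o, _, rfl⟩
  · simp only [linAt_unitRow, sval_pt]; push_cast; linarith [(h7 o).2]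
  · simp only [linAt_unitRow, sval_pt]; push_cast; linarith [(h7 o).1]

/-- S3 chord soundness. -/
theorem StationRowsCert.sqChordRow_sound (c : StationRowsCert) (h7 : ∀ o, (c.lo7 o : ℝ) ≤ dt (stPt o) ∧ dt (stPt o) ≤ c.hi7 o)
    (o : Option (Fin 3 × Bool)) : linAt (c.sqChordRow o).a (sval dt) 0 ≤ ((c.sqChordRow o).b : ℝ) := by
  simp only [StationRowsCert.sqChordRow, linAt_axpy, linAt_unitRow, sval_pt, sval_sq]
  push_cast
  nlinarith [sq_le_chord (h7 o).1 (h7 o).2]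

/-- S3 tangent soundness. -/
theorem sqTangentRow_sound (dt : (Fin 3 → ℤ) → ℝ) (oc : Option (Fin 3 × Bool) × ℚ) :
    linAt (sqTangentRow oc).a (sval dt) 0 ≤ ((sqTangentRow oc).b : ℝ) := by
  simp only [sqTangentRow, linAt_axpy, linAt_unitRow, sval_pt, sval_sq]
  push_cast
  nlinarith [tangent_le_sq (oc.2 : ℝ) (dt (stPt oc.1))]

/-- [cast] `depthProfileQ 160 = depthProfile 160` (108B `cast_depthProfileQ` with the numeral cast normalised). -/
theorem cast_depthProfileQ160 (t : ℚ) : ((depthProfileQ 160 t : ℚ) : ℝ) = depthProfile 160 (t : ℝ) := by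
  rw [cast_depthProfileQ]; norm_num

/-- [cast] the chord slope. -/
theorem cast_phiSlope (a b : ℚ) : ((phiSlope a b : ℚ) : ℝ) = (depthProfile 160 b - depthProfile 160 a) / ((b : ℝ) - a) := by
  simp only [phiSlope]; push_cast; rw [cast_depthProfileQ160, cast_depthProfileQ160]

/-- S4 chord soundness (N97 `depthProfile_chord_upper`). -/
theorem StationRowsCert.wChordRow_sound (c : StationRowsCert) (q : Fin 3 × Bool) (hlo : 80 ≤ c.lo q) (hlt : c.lo q < c.hi q) (hhi : c.hi q ≤ 134)
    (hq : (c.lo q : ℝ) ≤ dt (stPt (some q)) ∧ dt (stPt (some q)) ≤ c.hi q) :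
    linAt (c.wChordRow q).a (sval dt) 0 ≤ ((c.wChordRow q).b : ℝ) := by
  simp only [StationRowsCert.wChordRow, linAt_axpy, linAt_unitRow, sval_w]
  rw [show slotIx q = ptIx (some q) from rfl, sval_pt]
  push_cast
  rw [cast_phiSlope, cast_depthProfileQ160]
  have := depthProfile_chord_upper (lo := (c.lo q : ℝ)) (hi := (c.hi q : ℝ)) (by exact_mod_cast hlo) (by exact_mod_cast hhi) (by exact_mod_cast hlt)
    _ hq.1 hq.2
  linarith

/-- S4 secant soundness (N97 `depthProfile_secant_lower`). -/
theorem StationRowsCert.wSecantRow_sound (c : StationRowsCert) (qa : (Fin 3 × Bool) × ℚ) (ha : 80 ≤ qa.2) (halo : qa.2 < c.lo qa.1)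
    (hhi : c.hi qa.1 ≤ 134) (hq : (c.lo qa.1 : ℝ) ≤ dt (stPt (some qa.1)) ∧ dt (stPt (some qa.1)) ≤ c.hi qa.1) :
    linAt (c.wSecantRow qa).a (sval dt) 0 ≤ ((c.wSecantRow qa).b : ℝ) := by
  simp only [StationRowsCert.wSecantRow, linAt_axpy, linAt_unitRow, sval_w]
  rw [show slotIx qa.1 = ptIx (some qa.1) from rfl, sval_pt]
  push_cast
  rw [cast_phiSlope, cast_depthProfileQ160]
  have := depthProfile_secant_lower (a := (qa.2 : ℝ)) (lo := (c.lo qa.1 : ℝ)) (hi := (c.hi qa.1 : ℝ)) (by exact_mod_cast ha)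
    (by exact_mod_cast halo) (by exact_mod_cast hhi) _ hq.1 hq.2
  linarith

/-- ★★ **SOUNDNESS OF THE H-DESCRIPTION**: every emitted row holds at the valuation of a chart-realisable positive tuple in the station's box. -/
theorem StationRowsCert.rows_sound (c : StationRowsCert) (hok : c.ok = true) (hρ0 : (c.rho0 : ℝ) ≤ ρ) (hρ1 : ρ ≤ c.rho1)
    (hbox : ∀ q, (c.lo q : ℝ) ≤ dt (holeVertex 0 q) ∧ dt (holeVertex 0 q) ≤ c.hi q) (hC : (c.loC : ℝ) ≤ dt 0 ∧ dt 0 ≤ c.hiC)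
    (h : IsChartRealisable ρ dt) (hpos : ∀ p ∈ stencil 0, 0 < dt p) : ∀ r ∈ c.rows, linAt r.a (sval dt) 0 ≤ (r.b : ℝ) := by
  simp only [StationRowsCert.ok, Bool.and_eq_true, decide_eq_true_eq, List.all_eq_true] at hok
  obtain ⟨⟨⟨⟨h00, _, _⟩, hsl⟩, hsec⟩, hs2⟩ := hok
  have h7 := c.box7 hbox hC
  have hρ : 0 ≤ ρ := le_trans (by exact_mod_cast h00) hρ0
  intro r hr
  simp only [StationRowsCert.rows, List.mem_append, List.mem_map] at hr
  rcases hr with ((((hr | ⟨o, _, rfl⟩) | ⟨oc, _, rfl⟩) | ⟨q, _, rfl⟩) | ⟨qa, hqa, rfl⟩) | ⟨d, hd, rfl⟩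
  · exact c.boxRows_sound h7 r hr
  · exact c.sqChordRow_sound h7 o
  · exact sqTangentRow_sound dt oc
  · obtain ⟨hlo, hlt, hhi⟩ := hsl q (mem_slots6 q)
    exact c.wChordRow_sound q hlo hlt hhi (h7 (some q))
  · obtain ⟨ha, halo⟩ := hsec qa hqa
    obtain ⟨_, _, hhi⟩ := hsl qa.1 (mem_slots6 qa.1)
    exact c.wSecantRow_sound qa ha halo hhi (h7 (some qa.1))
  · exact d.row_sound (hs2 d hd) hρ hρ1 h hpos

end Station

end Summit.AtomisticToContinuum.Crystallization.Theorems.ChargedEnergyGapChartDial
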